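import Summits.CriticalPhenomena.PercolationContinuityZ3.Theorems.Transplant.AutChartQuasiTransitive
import Summits.CriticalPhenomena.PercolationContinuityZ3.Theorems.Transplant.AutPathMap
import Summits.CriticalPhenomena.PercolationContinuityZ3.Theorems.Transplant.LinearGrowthTransfer
import Summits.CriticalPhenomena.PercolationContinuityZ3.Theorems.Transplant.CayleyVirtuallyNilpotentDichotomy
import Literature.Combinatorics.SimpleGraph.PolynomialGrowthAutomorphismGroups
import Mathlib.Algebra.Order.Group.Action.End
import HarnessLib

/-!
# The END-STATE input holds for EVERY quasi-transitive graph of polynomial growth — kernel modulo Trofimov's theorem (1985, Thm. 2)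

builds on p205010 (kernel theorem, internal audit signed; external expert review pending) — nothing in this file uses p205010.  UNCONDITIONAL
except for the NAMED FACT `Literature.Combinatorics.SimpleGraph.Trofimov1985_polynomialGrowthBlocks` (Trofimov 1985, Thm. 2, typed in the
tree, unproved there; hypothesis `hT`).  Lane `prim-bschramm`, seat `prim-bschramm-p4` gen 27 (PART C3 of `P4-GENERAL.md` §49).  Helper file
(`--supports stmt-CriticalPhenomena-4575 --as helper`).  Def-free.  Sequel: `AutPolynomialGrowthEndStateConj4` (what the end-state node buys).

THE POINT.  Gens 25–26 settled the reach of the ONE-TYPE method: INPUT(G) = a TRANSITIVE `A ≤ Aut(G)` with a rank-two `ℤ²`-character killing a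
stabiliser (`AutChart.criticalContinuity`, modulo `U_s`), and on graphs with discrete `Aut` the WHOLE ladder (any number of types, quasi-steps) needs
`Aut(G)` to carry a QUASI-TRANSITIVE subgroup with a rank-two character killing EVERY vertex stabiliser (`AutDiscrete.aut_virtually_rankTwo_of_frmScaled`).
This file proves that this END-STATE INPUT is available on the whole polynomial-growth class:
**`AutPoly.exists_finiteOrbits_rankTwo`** — `G` connected, locally finite, QUASI-TRANSITIVE, of POLYNOMIAL GROWTH (`|B(x,n)| ≤ C (n+1)^D`), with
`p_c(G) < 1` somewhere ⟹ a subgroup `A₀ ≤ Aut(G)` with FINITELY MANY orbits and a homomorphism `c : A₀ → ℤ²` of RANK-TWO image KILLING THE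
STABILISER OF EVERY VERTEX (stabilisers arbitrary — infinite stabilisers of non-discrete automorphism groups included).  Kernel modulo `hT`.
PROOF.  `Aut(G)` acts transitively on the orbit Rips graph of one orbit (gen 25's `AutChart.orbitRips`; connected, locally finite, polynomial growth
`orbitRips_polynomialGrowth`); Trofimov gives an invariant finite-block system with block group `H = Aut(G)/K` finitely generated, virtually
nilpotent, with FINITE block stabilisers; the `π`-images of the automorphisms moving the base point into a finite set are finite (the one place the
finite block stabilisers enter); so `w ↦ π(a_w)` (`a_w` a section through the orbit representatives) is a rough map `G → Cay(H; S_H)` with bounded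
fibres (blocks have a common size, balls at orbit points a common volume) and gen 24's `GraphPathMap.criticalProb_lt_one_of_lipschitz` transfers
`p_c < 1` to `Cay(H; S_H)`; hence `H` is not virtually cyclic (gen 22's `VirtCyc.not_virtuallyCyclic_of_criticalProb_lt_one`), nor is a
finite-index nilpotent `N ≤ H`, which therefore has two independent characters (gen 22's `Nilpotent.virtuallyCyclic_iff_dependent`, Milnor–Wolf);
pull back to `A₀ = π⁻¹(N)` (finite index ⟹ finitely many orbits): the `c`-image of every vertex stabiliser is a finite subgroup of the torsion-free
`ℤ²`, i.e. trivial; rank two lifts along the surjection `π`.  In print: the polynomial-growth structure is Trofimov's; the percolation reading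
(P4-GENERAL §43.2) is not found in print (presearch 2026-08-25: corpus hybrid/vector + galaxy).
[cite: Trofimov1985, Thm. 2] [cite: Woess1991, Thm. 1] [cite: BenjaminiSchramm1996, Conj. 4; §2 (almost transitive graphs); Conj. 1; Thm. 1]
[cite: LyonsPeres2016, §7.4 Thm. 7.15 and the remark following it; §7.9] [cite: MilnorSolvableGrowth1968, Lemma 1]
-/

noncomputable section

namespace Summit.CriticalPhenomena.PercolationContinuityZ3.Theorems.Transplant

open SimpleGraph Filter Literature.Barriers.CriticalPhenomena Literature.Probability.LatticeModels Literature.Probability.Percolation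
open Literature.Combinatorics.SimpleGraph (Trofimov1985_polynomialGrowthBlocks)
open scoped Classical

namespace AutPoly

variable {V : Type} {G : SimpleGraph V} [G.LocallyFinite]

/-! ## §0 Tools -/

/-- `ℤ²` (as `Multiplicative (Site 2)`) is torsion-free: `x ^ n = 1`, `0 < n` ⟹ `x = 1`. [folklore] -/
theorem eq_one_of_pow_eq_one {x : Multiplicative (Site 2)} {n : ℕ} (hn : 0 < n) (h : x ^ n = 1) : x = 1 := by
  have hx : n • Multiplicative.toAdd x = 0 := by rw [← toAdd_pow, h, toAdd_one]
  rw [← ofAdd_toAdd x, ← ofAdd_zero]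
  congr 1
  funext i
  have hi : (n : ℤ) * Multiplicative.toAdd x i = 0 := by
    have := congrFun hx i
    rwa [Pi.smul_apply, nsmul_eq_mul] at this
  rcases mul_eq_zero.1 hi with h0 | h0
  · exact absurd (by exact_mod_cast h0 : n = 0) hn.ne'
  · exact h0

/-- A homomorphism to `ℤ²` whose values on a subgroup form a FINITE set kills the subgroup. [folklore] -/
theorem map_eq_one_of_finite_image {K : Type} [Group K] (c : K →* Multiplicative (Site 2)) (S : Subgroup K)
    (hfin : (c '' (S : Set K)).Finite) {σ : K} (hσ : σ ∈ S) : c σ = 1 := by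
  haveI : Finite (S.map c) := by
    have : ((S.map c : Subgroup _) : Set (Multiplicative (Site 2))).Finite := by
      rw [Subgroup.coe_map]; exact hfin
    exact this.to_subtype
  obtain ⟨n, hn, hpow⟩ := (isOfFinOrder_of_finite (⟨c σ, Subgroup.mem_map_of_mem c hσ⟩ : S.map c)).exists_pow_eq_one
  exact eq_one_of_pow_eq_one hn (by simpa using congrArg Subtype.val hpow)

section Orbit

variable {A : Type} [Group A] [MulAction A V] {t : V}

omit [G.LocallyFinite] in
/-- An edge of the orbit Rips graph at scale `m` is shadowed by a `G`-walk of length `≤ m`. [folklore] -/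
theorem orbitRips_adj_walk {m : ℕ} (x y : MulAction.orbit A t) (h : (AutChart.orbitRips G A t m).Adj x y) :
    ∃ wk : G.Walk (x : V) y, wk.length ≤ m := by
  obtain ⟨-, ⟨w, hw⟩⟩ := AutChart.orbitRips_adj.1 h
  exact ⟨w, hw⟩

/-- **The orbit Rips graph of a graph of polynomial growth has polynomial growth** (`|B_Rips(x, n)| ≤ |B_G(x, m n)|`). [folklore] -/
theorem orbitRips_polynomialGrowth (hpoly : ∃ C D : ℝ, ∀ (x : V) (n : ℕ), (ballVolume G x n : ℝ) ≤ C * ((n : ℝ) + 1) ^ D) (m : ℕ) :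
    ∃ C D : ℝ, ∀ (x : MulAction.orbit A t) (n : ℕ), (ballVolume (AutChart.orbitRips G A t m) x n : ℝ) ≤ C * ((n : ℝ) + 1) ^ D := by
  obtain ⟨C, D, hCD⟩ := hpoly
  refine ⟨max C 0 * ((m : ℝ) + 1) ^ max D 0, max D 0, fun x n => ?_⟩
  have hK : ∀ w : V, ((fun y : MulAction.orbit A t => (y : V)) ⁻¹' {w}).Finite ∧ ((fun y : MulAction.orbit A t => (y : V)) ⁻¹' {w}).ncard ≤ 1 :=
    fun w => by
      have hsub : ((fun y : MulAction.orbit A t => (y : V)) ⁻¹' {w}).Subsingleton := fun a ha b hb =>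
        Subtype.ext ((Set.mem_singleton_iff.1 ha).trans (Set.mem_singleton_iff.1 hb).symm)
      exact ⟨hsub.finite, (Set.ncard_le_one hsub.finite).2 fun a ha b hb => hsub ha hb⟩
  have h1 : ballVolume (AutChart.orbitRips G A t m) x n ≤ 1 * ballVolume G (x : V) (m * n) :=
    GrowthMap.ballVolume_le (H := AutChart.orbitRips G A t m) (G := G) (fun y => (y : V)) orbitRips_adj_walk hK x n
  rw [one_mul] at h1
  have h2 : (ballVolume G (x : V) (m * n) : ℝ) ≤ C * (((m * n : ℕ) : ℝ) + 1) ^ D := hCD x (m * n)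
  have hbase : (1 : ℝ) ≤ ((m * n : ℕ) : ℝ) + 1 := by linarith [show (0 : ℝ) ≤ ((m * n : ℕ) : ℝ) by positivity]
  have h3 : (((m * n : ℕ) : ℝ) + 1) ^ D ≤ (((m * n : ℕ) : ℝ) + 1) ^ max D 0 := Real.rpow_le_rpow_of_exponent_le hbase (le_max_left _ _)
  have h4 : (((m * n : ℕ) : ℝ) + 1) ^ max D 0 ≤ (((m : ℝ) + 1) * ((n : ℝ) + 1)) ^ max D 0 := by
    apply Real.rpow_le_rpow (by positivity) _ (le_max_right _ _)
    push_cast; nlinarith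
  have h5 : (((m : ℝ) + 1) * ((n : ℝ) + 1)) ^ max D 0 = ((m : ℝ) + 1) ^ max D 0 * ((n : ℝ) + 1) ^ max D 0 :=
    Real.mul_rpow (by positivity) (by positivity)
  have hpos : (0 : ℝ) ≤ (((m * n : ℕ) : ℝ) + 1) ^ D := by positivity
  calc (ballVolume (AutChart.orbitRips G A t m) x n : ℝ) ≤ ballVolume G (x : V) (m * n) := by exact_mod_cast h1
    _ ≤ C * (((m * n : ℕ) : ℝ) + 1) ^ D := h2
    _ ≤ max C 0 * (((m * n : ℕ) : ℝ) + 1) ^ D := by gcongr; exact le_max_left _ _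
    _ ≤ max C 0 * ((((m : ℝ) + 1) * ((n : ℝ) + 1)) ^ max D 0) := mul_le_mul_of_nonneg_left (h3.trans h4) (le_max_right _ _)
    _ = max C 0 * ((m : ℝ) + 1) ^ max D 0 * ((n : ℝ) + 1) ^ max D 0 := by rw [h5, mul_assoc]

end Orbit

/-! ## §1 The END-STATE input on quasi-transitive graphs of polynomial growth (kernel modulo Trofimov 1985, Thm. 2) -/

/-- **THEOREM (kernel modulo Trofimov's theorem): every connected, locally finite, QUASI-TRANSITIVE graph of POLYNOMIAL GROWTH with `p_c < 1`
carries a subgroup `A₀ ≤ Aut(G)` with FINITELY MANY orbits and a homomorphism `c : A₀ → ℤ²` of RANK-TWO image killing the stabiliser of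
EVERY vertex** (stabilisers may be infinite) — the chart-free input of any multi-type / quasi-step frames node (P4-GENERAL §41.5/§43.2/§49).
Proof: Trofimov's blocks on the orbit Rips graph of one `Aut(G)`-orbit; the block group `H` is finitely generated and virtually nilpotent with
finite block stabilisers; `p_c(G) < 1` transfers along the rough map `w ↦ π(a_w)` to a Cayley graph of `H` (Lyons–Peres Thm 7.15, remark),
so `H` is not virtually cyclic (gen 22); a finite-index nilpotent `N ≤ H` then has two independent characters (Milnor–Wolf, gen 22's
`Nilpotent.virtuallyCyclic_iff_dependent`); pull back to `A₀ = π⁻¹(N)`: vertex stabilisers map into finite sets of `H`, and `ℤ²` is torsion-free.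
[cite: Trofimov1985, Thm. 2] [cite: BenjaminiSchramm1996, §2 (almost transitive graphs); Conj. 4] [cite: LyonsPeres2016, §7.4 Thm. 7.15, §7.9]
[cite: MilnorSolvableGrowth1968, Lemma 1] -/
theorem exists_finiteOrbits_rankTwo (hT : Trofimov1985_polynomialGrowthBlocks) (hc : G.Connected) (hq : IsQuasiTransitive G)
    (hpoly : ∃ C D : ℝ, ∀ (x : V) (n : ℕ), (ballVolume G x n : ℝ) ≤ C * ((n : ℝ) + 1) ^ D) {v : V} (hpc : criticalProb G v < 1) :
    ∃ (A₀ : Subgroup (G ≃g G)) (reps : Finset V) (c : A₀ →* Multiplicative (Site 2)),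
      (∀ w : V, ∃ a : A₀, ∃ s ∈ reps, (a : G ≃g G) s = w) ∧ (∀ (a : A₀) (w : V), (a : G ≃g G) w = w → c a = 1) ∧
      ∃ a b : A₀, MaxArea.det2 (Multiplicative.toAdd (c a)) (Multiplicative.toAdd (c b)) ≠ 0 := by
  haveI : Countable V := countable_of_connected_of_locallyFinite G hc v
  have hact : IsActionByAut G (G ≃g G) := fun γ x y => γ.map_rel_iff'
  -- (0) the orbits of `Aut(G)`: representatives `V₀`, a section, a radius `R` covering the representatives from `v`
  obtain ⟨V₀, hV₀⟩ := hq
  have horb : ∀ w : V, ∃ a : G ≃g G, ∃ s ∈ V₀, a • s = w := fun w => by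
    obtain ⟨γ, hγ⟩ := hV₀ w
    exact ⟨γ⁻¹, γ w, hγ, RelIso.inv_apply_self γ w⟩
  choose asec rep hrep hsec using horb
  have hdist : ∀ s : V, ∃ n : ℕ, s ∈ graphBall G v n := fun s => by
    obtain ⟨w⟩ := hc.preconnected v s
    exact ⟨w.length, w, le_rfl⟩
  choose nd hnd using hdist
  set R : ℕ := V₀.sup nd with hR
  have hRrep : ∀ s ∈ V₀, s ∈ graphBall G v R := fun s hs => graphBall_mono _ _ (Finset.le_sup (f := nd) hs) (hnd s)
  have hdense : ∀ w : V, ∃ a : G ≃g G, w ∈ graphBall G (a • v) R := fun w => by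
    refine ⟨asec w, ?_⟩
    have h := (smul_mem_graphBall_iff hact (asec w)).2 (hRrep _ (hrep w))
    rwa [hsec w] at h
  -- (1) the orbit Rips graph of the orbit of `v` at scale `m = 2R + 1`: connected, locally finite, `Aut(G)` transitive, polynomial growth
  set m : ℕ := 2 * R + 1 with hm
  have hactH := AutChart.orbitRips_isActionByAut (G := G) (A := G ≃g G) (t := v) hact m
  have hcH := AutChart.orbitRips_connected (G := G) (A := G ≃g G) (t := v) hc hdense
  have htrH : ∀ x y : MulAction.orbit (G ≃g G) v, ∃ a : G ≃g G, a • x = y := fun x y => by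
    obtain ⟨a, ha⟩ := AutChart.orbit_transitive (A := G ≃g G) (t := v) x
    obtain ⟨b, hb⟩ := AutChart.orbit_transitive (A := G ≃g G) (t := v) y
    exact ⟨b * a⁻¹, by rw [mul_smul, ← ha, inv_smul_smul, hb]⟩
  -- (2) Trofimov's blocks
  obtain ⟨r, hrA, hrfin, H, hGrp, hAct, π, hπsurj, hπact, -, hFG, ⟨N, hNfi, hNnil⟩, hstabH⟩ :=
    hT (AutChart.orbitRips G (G ≃g G) v m) hcH (orbitRips_polynomialGrowth hpoly m) hactH htrH
  set ob : MulAction.orbit (G ≃g G) v := AutChart.obase (G ≃g G) v with hob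
  set q₀ : Quotient r := Quotient.mk r ob with hq₀
  have hstab_q₀ : ∀ a : G ≃g G, a • v = v → π a • q₀ = q₀ := fun a ha => by
    rw [hq₀, hπact]
    congr 1
    exact Subtype.ext (by rw [MulAction.orbit.coe_smul]; exact ha)
  -- (F) the `π`-images of the movers of `v` into a finite set are finite
  have hFu : ∀ u : V, (π '' {β : G ≃g G | β • v = u}).Finite := fun u => by
    by_cases hu : ∃ β₀ : G ≃g G, β₀ • v = u
    · obtain ⟨β₀, hβ₀⟩ := hu
      refine ((hstabH q₀).image fun h => π β₀ * h).subset ?_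
      rintro _ ⟨β, hβ, rfl⟩
      refine ⟨π (β₀⁻¹ * β), ?_, by show π β₀ * π (β₀⁻¹ * β) = π β; rw [← map_mul, mul_inv_cancel_left]⟩
      show π (β₀⁻¹ * β) • q₀ = q₀
      apply hstab_q₀
      rw [mul_smul, show β • v = u from hβ, ← hβ₀, inv_smul_smul]
    · have he : {β : G ≃g G | β • v = u} = ∅ := Set.eq_empty_of_forall_notMem fun β hβ => hu ⟨β, hβ⟩
      rw [he, Set.image_empty]
      exact Set.finite_empty
  have hFball : ∀ (w : V) (k : ℕ), (π '' {β : G ≃g G | β • v ∈ graphBall G w k}).Finite := fun w k => by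
    refine ((graphBall_finite G w k).biUnion fun u _ => hFu u).subset ?_
    rintro _ ⟨β, hβ, rfl⟩
    exact Set.mem_biUnion hβ ⟨β, rfl, rfl⟩
  -- (3) generators
  haveI : Group.FG H := hFG
  haveI : N.FiniteIndex := hNfi
  haveI : Group.IsNilpotent N := hNnil
  haveI : Group.FG N := Subgroup.fg_of_index_ne_zero N
  obtain ⟨-, SH, -, hSH⟩ := Group.fg_iff'.1 hFG
  obtain ⟨-, SN, -, hSN⟩ := Group.fg_iff'.1 (inferInstance : Group.FG N)
  -- (4) `H` is not virtually cyclic: `w ↦ π (asec w)` is a rough map `G → Cay(H; SH)` with bounded fibres, so `p_c(Cay(H; SH)) < 1`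
  have hnvc : ¬ ∃ c : H, (Subgroup.zpowers c).FiniteIndex := by
    set f : V → H := fun w => π (asec w) with hf
    have hF := hFball v m
    choose wd hwd using fun x : H => CayleyZSq.exists_word (S := SH) hSH x
    set L : ℕ := hF.toFinset.sup fun h => (wd h).length with hL
    -- (4a) Lipschitz
    have hLip : ∀ x y, G.Adj x y → ∃ wk : (mulCayley (↑SH : Set H)).Walk (f x) (f y), wk.length ≤ L := by
      intro x y hxy
      set μ : G ≃g G := (asec x)⁻¹ * asec y with hμ
      have hμmem : π μ ∈ hF.toFinset := by
        rw [Set.Finite.mem_toFinset]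
        refine ⟨μ, ?_, rfl⟩
        show μ • v ∈ graphBall G v m
        have h2 : G.Adj (rep x) (μ • rep y) := by
          rw [hμ, mul_smul, hsec y, ← hact (asec x), smul_inv_smul, hsec x]; exact hxy
        have h4 : μ • rep y ∈ graphBall G v (R + 1) := mem_graphBall_add G (hRrep _ (hrep x)) (mem_graphBall_one_of_adj G h2)
        have h5 : μ • v ∈ graphBall G (μ • rep y) R := (smul_mem_graphBall_iff hact μ).2 ((mem_graphBall_comm G).1 (hRrep _ (hrep y)))
        exact graphBall_mono _ _ (by omega) (mem_graphBall_add G h4 h5)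
      obtain ⟨wk, hwk⟩ := CayleyComm.exists_walk_word SH (wd (π μ)) (hwd (π μ)).1 (f x)
      have hend : f x * (wd (π μ)).prod = f y := by
        rw [(hwd (π μ)).2, hf, hμ, ← map_mul, mul_inv_cancel_left]
      refine ⟨wk.copy rfl hend, ?_⟩
      rw [Walk.length_copy, hwk]
      exact Finset.le_sup (f := fun h => (wd h).length) hμmem
    -- (4b) blocks of the orbit have a common finite size; balls at orbit points have a common size
    have hblk_fin : ∀ q : Quotient r, {x : MulAction.orbit (G ≃g G) v | Quotient.mk r x = q}.Finite := fun q => by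
      induction q using Quotient.inductionOn with
      | h x₀ => exact (hrfin x₀).subset fun x hx => Quotient.exact hx
    have hblk_card : ∀ b : H, {x : MulAction.orbit (G ≃g G) v | Quotient.mk r x = b • q₀}.ncard =
        {x : MulAction.orbit (G ≃g G) v | Quotient.mk r x = q₀}.ncard := fun b => by
      obtain ⟨a, rfl⟩ := hπsurj b
      rw [hq₀, hπact]
      have he : {x : MulAction.orbit (G ≃g G) v | Quotient.mk r x = Quotient.mk r (a • ob)} =
          (fun x => a • x) '' {x | Quotient.mk r x = Quotient.mk r ob} := by
        ext x
        constructor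
        · intro hx
          refine ⟨a⁻¹ • x, ?_, smul_inv_smul a x⟩
          have h1 := hrA a⁻¹ _ _ (Quotient.exact hx)
          rw [inv_smul_smul] at h1
          exact Quotient.sound h1
        · rintro ⟨y, hy, rfl⟩
          exact Quotient.sound (hrA a _ _ (Quotient.exact hy))
      rw [he, Set.ncard_image_of_injective _ (MulAction.injective a)]
    have hball_card : ∀ x : MulAction.orbit (G ≃g G) v, (graphBall G (x : V) R).ncard = ballVolume G v R := fun x => by
      obtain ⟨a, ha⟩ := AutChart.orbit_transitive (A := G ≃g G) (t := v) x
      have hx : (x : V) = a v := by rw [← ha]; rfl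
      rw [hx, graphBall_map_eq_image a v R, Set.ncard_image_of_injective _ a.injective, ballVolume]
    -- (4c) fibres of `f`
    set β₁ : ℕ := {x : MulAction.orbit (G ≃g G) v | Quotient.mk r x = q₀}.ncard with hβ₁
    have hK : ∀ b : H, (f ⁻¹' {b}).Finite ∧ (f ⁻¹' {b}).ncard ≤ β₁ * ballVolume G v R := fun b => by
      have hsub : f ⁻¹' {b} ⊆ ⋃ x ∈ (hblk_fin (b • q₀)).toFinset, graphBall G (x : V) R := by
        intro w hw
        have hw' : π (asec w) = b := hw
        have hxblk : asec w • ob ∈ {x : MulAction.orbit (G ≃g G) v | Quotient.mk r x = b • q₀} := by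
          show Quotient.mk r (asec w • ob) = b • q₀
          rw [← hw', hq₀, hπact]
        refine Set.mem_biUnion ((Set.Finite.mem_toFinset _).2 hxblk) ?_
        have h := (smul_mem_graphBall_iff hact (asec w)).2 (hRrep _ (hrep w))
        rw [hsec w] at h
        exact h
      have hfin : (⋃ x ∈ (hblk_fin (b • q₀)).toFinset, graphBall G (x : V) R).Finite :=
        Set.Finite.biUnion (Finset.finite_toSet _) fun x _ => graphBall_finite G _ R
      refine ⟨hfin.subset hsub, (Set.ncard_le_ncard hsub hfin).trans ?_⟩
      calc (⋃ x ∈ (hblk_fin (b • q₀)).toFinset, graphBall G (x : V) R).ncard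
          ≤ ∑ x ∈ (hblk_fin (b • q₀)).toFinset, (graphBall G (x : V) R).ncard := ncard_biUnion_le _ _
        _ = ∑ x ∈ (hblk_fin (b • q₀)).toFinset, ballVolume G v R := Finset.sum_congr rfl fun x _ => hball_card x
        _ = β₁ * ballVolume G v R := by
            rw [Finset.sum_const, smul_eq_mul, ← Set.ncard_eq_toFinset_card _ (hblk_fin _), hblk_card b]
    -- (4d) degrees
    have hDH : ∀ w, G.degree w ≤ V₀.sup fun s => G.degree s := fun w => by
      rw [← hsec w, ← smulIso_apply hact (asec w) (rep w), (smulIso hact (asec w)).degree_eq (rep w)]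
      exact Finset.le_sup (f := fun s => G.degree s) (hrep w)
    have h := GraphPathMap.criticalProb_lt_one_of_lipschitz (H := G) (G := mulCayley (↑SH : Set H)) f hLip hK hDH
      (degree_mulCayley_le SH) v hpc
    exact VirtCyc.not_virtuallyCyclic_of_criticalProb_lt_one SH hSH (f v) h
  -- (5) two independent characters of the finite-index nilpotent subgroup `N`
  have hnvcN : ¬ ∃ c : N, (Subgroup.zpowers c).FiniteIndex := fun ⟨c, hc'⟩ =>
    hnvc ⟨(c : H), VirtNilpotent.finiteIndex_zpowers_of_subgroup N c hc'⟩
  have hind : ∃ (ψ₀ ψ₁ : N →* Multiplicative ℤ) (a b : N),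
      Multiplicative.toAdd (ψ₀ a) * Multiplicative.toAdd (ψ₁ b) ≠ Multiplicative.toAdd (ψ₁ a) * Multiplicative.toAdd (ψ₀ b) := by
    by_contra h
    refine hnvcN ((Nilpotent.virtuallyCyclic_iff_dependent SN hSN).2 fun ψ₀ ψ₁ a b => ?_)
    by_contra hne
    exact h ⟨ψ₀, ψ₁, a, b, hne⟩
  obtain ⟨ψ₀, ψ₁, a₁, b₁, hind⟩ := hind
  -- (6) pull back to `A₀ = π⁻¹(N)`
  set A₀ : Subgroup (G ≃g G) := N.comap π with hA₀
  let πN : A₀ →* N := (π.restrict A₀).codRestrict N fun a => a.2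
  have hπN : ∀ a : A₀, ((πN a : N) : H) = π (a : G ≃g G) := fun a => rfl
  set c : A₀ →* Multiplicative (Site 2) := (CayleyScaled.pairHom ψ₀ ψ₁).comp πN with hcdef
  -- (7) `A₀` has finite index, hence finitely many orbits
  haveI hA₀fi : A₀.FiniteIndex := ⟨by rw [hA₀, Subgroup.index_comap_of_surjective N hπsurj]; exact hNfi.index_ne_zero⟩
  let ρ : (G ≃g G) → (G ≃g G) := fun a => ((QuotientGroup.mk (a⁻¹) : (G ≃g G) ⧸ A₀).out)⁻¹
  have hρ : ∀ a : G ≃g G, a * (ρ a)⁻¹ ∈ A₀ := fun a => by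
    obtain ⟨k, hk⟩ := QuotientGroup.mk_out_eq_mul A₀ a⁻¹
    show a * (((QuotientGroup.mk (a⁻¹) : (G ≃g G) ⧸ A₀).out)⁻¹)⁻¹ ∈ A₀
    rw [inv_inv, hk, mul_inv_cancel_left]
    exact k.2
  set X : Finset (G ≃g G) := (Set.finite_range fun q : (G ≃g G) ⧸ A₀ => (q.out)⁻¹).toFinset with hX
  have hρX : ∀ a, ρ a ∈ X := fun a => by rw [hX, Set.Finite.mem_toFinset]; exact ⟨_, rfl⟩
  refine ⟨A₀, (X ×ˢ V₀).image fun p => p.1 • p.2, c, fun w => ?_, fun a w haw => ?_, ?_⟩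
  · -- orbits: `w = (asec w ρ⁻¹) • (ρ • rep w)`
    refine ⟨⟨asec w * (ρ (asec w))⁻¹, hρ _⟩, ρ (asec w) • rep w,
      Finset.mem_image.2 ⟨(ρ (asec w), rep w), Finset.mem_product.2 ⟨hρX _, hrep w⟩, rfl⟩, ?_⟩
    show (asec w * (ρ (asec w))⁻¹) • ρ (asec w) • rep w = w
    rw [← mul_smul, inv_mul_cancel_right, hsec]
  · -- stabilisers: the `c`-image of `Stab_{A₀}(w)` is finite, hence trivial
    obtain ⟨wk⟩ := hc.preconnected w v
    refine map_eq_one_of_finite_image c (MulAction.stabilizer A₀ w) ?_ (by rw [MulAction.mem_stabilizer_iff]; exact haw)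
    have hfinN : {n : N | (n : H) ∈ π '' {β : G ≃g G | β • v ∈ graphBall G w wk.length}}.Finite :=
      (hFball w wk.length).preimage Subtype.val_injective.injOn
    refine (hfinN.image (CayleyScaled.pairHom ψ₀ ψ₁)).subset ?_
    rintro _ ⟨σ, hσ, rfl⟩
    refine ⟨πN σ, ?_, rfl⟩
    show ((πN σ : N) : H) ∈ π '' {β : G ≃g G | β • v ∈ graphBall G w wk.length}
    refine ⟨(σ : G ≃g G), ?_, (hπN σ).symm⟩
    show (σ : G ≃g G) • v ∈ graphBall G w wk.length
    have hσw : (σ : G ≃g G) • w = w := MulAction.mem_stabilizer_iff.1 hσ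
    have h := (smul_mem_graphBall_iff hact (σ : G ≃g G) (x := w) (y := v)).2 ⟨wk, le_rfl⟩
    rwa [hσw] at h
  · -- rank two: lift the witnesses from `N`
    obtain ⟨α, hα⟩ := hπsurj (a₁ : H)
    obtain ⟨β, hβ⟩ := hπsurj (b₁ : H)
    have hαm : α ∈ A₀ := by rw [hA₀, Subgroup.mem_comap, hα]; exact a₁.2
    have hβm : β ∈ A₀ := by rw [hA₀, Subgroup.mem_comap, hβ]; exact b₁.2
    have hca : πN ⟨α, hαm⟩ = a₁ := Subtype.ext (by rw [hπN]; exact hα)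
    have hcb : πN ⟨β, hβm⟩ = b₁ := Subtype.ext (by rw [hπN]; exact hβ)
    refine ⟨⟨α, hαm⟩, ⟨β, hβm⟩, ?_⟩
    rw [hcdef, MonoidHom.comp_apply, MonoidHom.comp_apply, hca, hcb, MaxArea.det2, CayleyScaled.toAdd_pairHom_zero,
      CayleyScaled.toAdd_pairHom_one, CayleyScaled.toAdd_pairHom_zero, CayleyScaled.toAdd_pairHom_one]
    exact sub_ne_zero.2 hind

end AutPoly

end Summit.CriticalPhenomena.PercolationContinuityZ3.Theorems.Transplant

end
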